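import Mathlib.Analysis.Matrix.Order
import Mathlib.Analysis.SpecialFunctions.Exponential
import Literature.Analysis.Matrix.SchoenbergKernelsProofs

/-!
# Crux `AnalyticDetour` (stmt-QuantumFields-8801), line `registered`:
# the stub `stub_expPosSemidef` (entrywise exponential preserves positive semidefiniteness)

Registered stub of the skeleton `Cruxes/AnalyticDetour/Lines/registered.lean` (route
`GronwallGap`, sub-problem `YangMills`), proved verbatim: for a real positive semidefinite matrix
`A : Matrix (Fin n) (Fin n) ℝ`, the entrywise exponential `A.map Real.exp = (exp A_ij)_{ij}` is
positive semidefinite.  In the line this is the "positive type" clause of admissibility for the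
Wilson weight `w(g) = exp(β Re tr ρ(g))`: the kernel `exp(β Re tr(ρ(x)ᴴ ρ(y)))` is the entrywise
exponential of a Gram matrix.

Proof: this is the classical corollary of the Schur product theorem (Hadamard powers `A^{⊙k}` are
positive semidefinite, hence so are the partial sums `∑_{k<N} A^{⊙k}/k!`, and the positive
semidefinite cone is closed under entrywise limits).  The tree already has it in kernel language,
Berg–Christensen–Ressel Ch. 3 Cor. 1.14: `Literature.Analysis.Matrix.IsPosDefKernel.exp`
(`Literature/Analysis/Matrix/SchoenbergKernelsProofs.lean`, built on Mathlib's
`Matrix.PosSemidef.hadamard` and `NormedSpace.expSeries_div_hasSum_exp`).  We view the entries of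
`A` as a kernel on `Fin n` — positive definite because every principal submatrix
`A.submatrix x x` is positive semidefinite (`Matrix.PosSemidef.submatrix`,
`Literature.Analysis.Matrix.sum_mul_mul_nonneg_of_posSemidef`) — exponentiate it, and come back to
matrices with `Literature.Analysis.Matrix.IsPosDefKernel.posSemidef_matrix` on the identity family.

No named facts are used; no definitions are introduced.
-/

namespace Summit.QuantumFields.YangMills.Theorems

open Literature.Analysis.Matrix in
/-- **Stub `stub_expPosSemidef` — entrywise exponential preserves positive semidefiniteness.**
For every real positive semidefinite matrix `A` on `Fin n`, the matrix `(exp (A i j))_{i j}` is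
positive semidefinite (Schur product theorem + exponential series + closedness of the positive
semidefinite cone; here through the kernel form `IsPosDefKernel.exp`, BCR Ch. 3 Cor. 1.14). -/
theorem stub_expPosSemidef :
    ∀ (n : ℕ) (A : Matrix (Fin n) (Fin n) ℝ), A.PosSemidef → (A.map Real.exp).PosSemidef := by
  intro n A hA
  -- the entries of `A` form a positive definite kernel on `Fin n`
  have hK : IsPosDefKernel fun i j : Fin n => A i j := by
    refine ⟨fun i j => ?_, fun m x c => ?_⟩
    · have h := hA.1.apply j i
      rwa [star_trivial] at h
    · simpa only [Matrix.submatrix_apply] using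
        sum_mul_mul_nonneg_of_posSemidef (hA.submatrix x) c
  -- exponentiate the kernel (BCR Cor. 1.14) and read it back as the matrix `A.map exp`
  exact hK.exp.posSemidef_matrix id

end Summit.QuantumFields.YangMills.Theorems
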